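import Summits.QuantumFields.YangMills.Theorems.LuscherReductionTwistedTraceScalingToronPlaneWaves
import Summits.QuantumFields.YangMills.Theorems.LuscherReductionTwistedTraceScalingToronFrames
import HarnessLib

/-!
# The spectrum of the twisted curl: a plane-wave eigenframe of `‖D_φ w‖²` with values `{0, ‖q̂_j‖², ‖q̂_j‖²}_j`, hence
# `Σ_modes modeZPE(κ·a) = 2·toronZPE L κ 0 φ` for EVERY diagonalising frame — complex (charged) sector and real (neutral) sector
# (spectral-bridge brick C3a for the VALLEY term, crux `TwistedTraceScaling` stmt-QuantumFields-20203 S-BASE; design note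
# `pub/ym-fleet/ym-luscher-20007-p1/COARSE-DESIGN.md` §12 (ii))

* `exists_polarFrame` : for `q ∈ ℂ³` an orthonormal basis `b₀, b₁, b₂` of `ℂ³` with `⟪b_s, q⟫ = [s = 0]·‖q‖` (longitudinal `b₀ ∥ q`, transverse `b₁, b₂ ⊥ q`);
* `pwFrame L φ` : the orthonormal basis `{χ_j ⊗ b_{j,s}}` of `ℂ^{Edge}` indexed by `Site 3 L × Fin 3`, `pwValue L φ (j,s) = [s ≠ 0]·‖q̂_j(φ)‖²`;
  ★★ `isDiag_twCurl_pwFrame : Frame.IsDiag (twCurl L φ) (pwFrame L φ) (pwValue L φ)` (longitudinal modes are zero modes, transverse modes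
  carry `‖q̂_j‖² = lap3`);
* ★★ `sum_modeZPE_of_isDiag_twCurl` : for EVERY orthonormal frame `(e, a)` diagonalising `‖D_φ·‖²` on `ℂ^{Edge}`:
  `Σᵢ modeZPE(κ aᵢ) = 2·toronZPE L κ 0 φ` (complex multiplicity 2 per momentum: the two transverse polarisations);
* the NEUTRAL (real) sector: `reCurl L` = the plain curl on real scalar link fields, its complexification is `twCurl L 0`
  (`twCurl_zero_cplxE`), so ★★ `sum_modeZPE_of_isDiag_reCurl` : every real orthonormal frame diagonalising `‖reCurl·‖²` has
  `Σᵢ modeZPE(κ aᵢ) = 2·toronZPE L κ 0 0`.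

HONEST FRAMING: finite Fourier analysis / linear algebra at fixed `L`; femto rung R2b1 (brick for a stub of a child of a CONDITIONAL route);
not a gap, not Clay.
-/

set_option autoImplicit false

noncomputable section

open Finset Module
open scoped BigOperators ComplexConjugate InnerProductSpace
open Literature.MathematicalPhysics.QuantumFieldTheory

namespace Summit.QuantumFields.YangMills.Theorems.FemtoTransferGap.TwoLattice.Toron

open Summit.QuantumFields.YangMills.Theorems.FemtoTransferGap

variable (L : ℕ) [NeZero L]

/-! ## §1 Polarisation frames in `ℂ³` -/

/-- For every `q ∈ ℂ³` there is an orthonormal basis `b` of `ℂ³` adapted to it: `⟪b_s, q⟫ = [s = 0]·‖q‖` (for `q ≠ 0`: `b₀ = q/‖q‖`,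
`b₁, b₂` transverse; for `q = 0` any basis). [cite: HornJohnson2013, Thm 2.1.4] -/
theorem exists_polarFrame (q : EuclideanSpace ℂ (Fin 3)) :
    ∃ b : OrthonormalBasis (Fin 3) ℂ (EuclideanSpace ℂ (Fin 3)), ∀ s, ⟪b s, q⟫_ℂ = if s = 0 then ((‖q‖ : ℝ) : ℂ) else 0 := by
  by_cases hq : q = 0
  · refine ⟨EuclideanSpace.basisFun (Fin 3) ℂ, fun s => ?_⟩
    subst hq; simp
  · have hqn : ‖q‖ ≠ 0 := norm_ne_zero_iff.mpr hq
    set u : EuclideanSpace ℂ (Fin 3) := ((‖q‖⁻¹ : ℝ) : ℂ) • q with hu_def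
    have hu : ‖u‖ = 1 := by
      rw [hu_def, norm_smul, Complex.norm_real, Real.norm_eq_abs, abs_of_nonneg (inv_nonneg.2 (norm_nonneg q)), inv_mul_cancel₀ hqn]
    have hon : Orthonormal ℂ (({0} : Set (Fin 3)).restrict fun _ : Fin 3 => u) := by
      refine ⟨fun _ => hu, fun {i j} hij => ?_⟩
      exact absurd (Subtype.ext ((Set.mem_singleton_iff.mp i.2).trans (Set.mem_singleton_iff.mp j.2).symm)) hij
    obtain ⟨b, hb⟩ := hon.exists_orthonormalBasis_extension_of_card_eq (finrank_euclideanSpace (𝕜 := ℂ) (ι := Fin 3))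
    have hb0 : b 0 = u := hb 0 (Set.mem_singleton _)
    have hqu : q = ((‖q‖ : ℝ) : ℂ) • u := by
      rw [hu_def, smul_smul, ← Complex.ofReal_mul, mul_inv_cancel₀ hqn, Complex.ofReal_one, one_smul]
    refine ⟨b, fun s => ?_⟩
    conv_lhs => rw [hqu]
    rw [inner_smul_right, ← hb0, orthonormal_iff_ite.mp b.orthonormal s 0]
    split_ifs <;> simp

/-! ## §2 The plane-wave frame of the complex twisted curl -/

/-- A polarisation frame adapted to the symbol `q̂_j(φ)` (a choice). [folklore] -/
def polar (φ : Fin 3 → ℝ) (j : Site 3 L) : OrthonormalBasis (Fin 3) ℂ (EuclideanSpace ℂ (Fin 3)) :=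
  (exists_polarFrame (qhat L φ j)).choose

/-- `⟪b_{j,s}, q̂_j⟫ = [s = 0]·‖q̂_j‖`. [folklore] -/
theorem inner_polar_qhat (φ : Fin 3 → ℝ) (j : Site 3 L) (s : Fin 3) :
    ⟪polar L φ j s, qhat L φ j⟫_ℂ = if s = 0 then ((‖qhat L φ j‖ : ℝ) : ℂ) else 0 :=
  (exists_polarFrame (qhat L φ j)).choose_spec s

/-- `⟪q̂_j, b_{j,s}⟫ = [s = 0]·‖q̂_j‖`. [folklore] -/
theorem inner_qhat_polar (φ : Fin 3 → ℝ) (j : Site 3 L) (s : Fin 3) :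
    ⟪qhat L φ j, polar L φ j s⟫_ℂ = if s = 0 then ((‖qhat L φ j‖ : ℝ) : ℂ) else 0 := by
  rw [← inner_conj_symm, inner_polar_qhat]
  split_ifs <;> simp

/-- The plane-wave frame vectors `χ_j ⊗ b_{j,s}`. [cite: Luscher1983, §3] -/
def pwFrameVec (φ : Fin 3 → ℝ) (m : Site 3 L × Fin 3) : EuclideanSpace ℂ (Edge 3 L) := planeWave L m.1 (polar L φ m.1 m.2)

/-- The plane-wave frame vectors are orthonormal. [folklore] -/
theorem orthonormal_pwFrameVec (φ : Fin 3 → ℝ) : Orthonormal ℂ (pwFrameVec L φ) := by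
  rw [orthonormal_iff_ite]
  rintro ⟨j, s⟩ ⟨j', s'⟩
  simp only [pwFrameVec, inner_planeWave]
  by_cases hj : j = j'
  · subst hj
    rw [if_pos rfl, orthonormal_iff_ite.mp (polar L φ j).orthonormal s s']
    simp
  · rw [if_neg hj, if_neg (fun h => hj (Prod.mk.inj h).1)]

/-- ★ **The plane-wave frame**: an orthonormal basis of `ℂ^{Edge}` indexed by momentum × polarisation. [cite: Luscher1983, §3] -/
def pwFrame (φ : Fin 3 → ℝ) : OrthonormalBasis (Site 3 L × Fin 3) ℂ (EuclideanSpace ℂ (Edge 3 L)) :=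
  OrthonormalBasis.mk (orthonormal_pwFrameVec L φ)
    ((orthonormal_pwFrameVec L φ).linearIndependent.span_eq_top_of_card_eq_finrank' finrank_euclideanSpace.symm).ge

/-- The frame vectors. [folklore] -/
theorem pwFrame_apply (φ : Fin 3 → ℝ) (m : Site 3 L × Fin 3) : pwFrame L φ m = planeWave L m.1 (polar L φ m.1 m.2) := by
  rw [pwFrame, OrthonormalBasis.coe_mk]; rfl

/-- The values of the plane-wave frame: longitudinal `0`, transverse `‖q̂_j‖²`. [cite: Luscher1983, §3] -/
def pwValue (φ : Fin 3 → ℝ) (m : Site 3 L × Fin 3) : ℝ := if m.2 = 0 then 0 else ‖qhat L φ m.1‖ ^ 2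

/-- ★★ **The plane-wave frame diagonalises the form of the twisted curl**, with the values `pwValue`. [cite: Luscher1983, §3] -/
theorem isDiag_twCurl_pwFrame (φ : Fin 3 → ℝ) : Frame.IsDiag (twCurl L φ) (pwFrame L φ) (pwValue L φ) := by
  rintro ⟨j, s⟩ ⟨j', s'⟩
  rw [pwFrame_apply, pwFrame_apply, inner_twCurl_planeWave]
  by_cases hj : j = j'
  · subst hj
    simp only [true_and, Prod.mk.injEq, pwValue, if_true]
    rw [orthonormal_iff_ite.mp (polar L φ j).orthonormal s s', inner_polar_qhat, inner_qhat_polar]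
    by_cases hs : s = 0 <;> by_cases hs' : s' = 0
    · subst hs; subst hs'; simp [sq]
    · subst hs; simp [hs', Ne.symm hs']
    · subst hs'; simp [hs]
    · by_cases hss : s = s'
      · subst hss; simp [hs]
      · simp [hs, hss]
  · rw [if_neg hj, if_neg (fun h => hj (Prod.mk.inj h).1)]

/-! ## §3 Summing over the frame: `2·toronZPE` -/

/-- Summing a function vanishing at `0` over the plane-wave values: twice the sum over momenta of `f(‖q̂_j‖²)`. [folklore] -/
theorem sum_pwValue (φ : Fin 3 → ℝ) (f : ℝ → ℝ) (hf : f 0 = 0) :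
    ∑ m, f (pwValue L φ m) = 2 * ∑ j : Site 3 L, f (‖qhat L φ j‖ ^ 2) := by
  rw [Fintype.sum_prod_type, mul_sum]
  refine sum_congr rfl fun j _ => ?_
  have h0 : pwValue L φ (j, 0) = 0 := by simp [pwValue]
  have h1 : pwValue L φ (j, 1) = ‖qhat L φ j‖ ^ 2 := by simp [pwValue]
  have h2 : pwValue L φ (j, 2) = ‖qhat L φ j‖ ^ 2 := by simp [pwValue]
  rw [Fin.sum_univ_three, h0, h1, h2, hf]
  ring

/-- Momentum labels `(ℤ/L)³ ≃ (Fin L)³` (reading a residue through `ZMod.val`). [folklore] -/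
def siteFinEquiv : Site 3 L ≃ (Fin 3 → Fin L) := Equiv.piCongrRight fun _ => (ZMod.finEquiv L).toEquiv.symm

/-- The equivalence reads the residue's `val`. [folklore] -/
theorem siteFinEquiv_apply_val (j : Site 3 L) (k : Fin 3) : ((siteFinEquiv L j k : Fin L) : ℕ) = (j k).val := by
  obtain ⟨n, hn⟩ := Nat.exists_eq_succ_of_ne_zero (NeZero.ne L)
  subst hn
  rfl

/-- `‖q̂_j(φ)‖² = lap3 L φ (siteFinEquiv j)`. [cite: Luscher1983, §3] -/
theorem norm_qhat_sq_eq_lap3_equiv (φ : Fin 3 → ℝ) (j : Site 3 L) : ‖qhat L φ j‖ ^ 2 = lap3 L φ (siteFinEquiv L j) := by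
  rw [norm_qhat_sq]
  simp only [lap3, lap1, siteFinEquiv_apply_val]

/-- ★ `Σ_j modeZPE(κ‖q̂_j(φ)‖²) = toronZPE L κ 0 φ`. [cite: Luscher1983, §3] -/
theorem sum_modeZPE_norm_qhat_sq (φ : Fin 3 → ℝ) (κ : ℝ) :
    ∑ j : Site 3 L, modeZPE (κ * ‖qhat L φ j‖ ^ 2) = toronZPE L κ 0 φ := by
  unfold toronZPE
  exact Fintype.sum_equiv (siteFinEquiv L) _ _ fun j => by rw [norm_qhat_sq_eq_lap3_equiv, zero_add]

/-- ★ The plane-wave frame's zero-point sum: `Σ_m modeZPE(κ·pwValue m) = 2·toronZPE L κ 0 φ`. [cite: Luscher1983, §3] -/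
theorem sum_modeZPE_pwValue (φ : Fin 3 → ℝ) (κ : ℝ) : ∑ m, modeZPE (κ * pwValue L φ m) = 2 * toronZPE L κ 0 φ := by
  rw [sum_pwValue L φ (fun y => modeZPE (κ * y)) (by rw [mul_zero, modeZPE_zero]), sum_modeZPE_norm_qhat_sq]

/-- ★★ **CHARGED-SECTOR SPECTRAL SUM, frame-free**: for EVERY orthonormal frame `(e, a)` of `ℂ^{Edge}` diagonalising `‖D_φ w‖²`,
`Σᵢ modeZPE(κ aᵢ) = 2·toronZPE L κ 0 φ`. [cite: Luscher1983, §3] -/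
theorem sum_modeZPE_of_isDiag_twCurl (φ : Fin 3 → ℝ) {ι : Type*} [Fintype ι] [DecidableEq ι]
    {e : OrthonormalBasis ι ℂ (EuclideanSpace ℂ (Edge 3 L))} {a : ι → ℝ} (h : Frame.IsDiag (twCurl L φ) e a) (κ : ℝ) :
    ∑ i, modeZPE (κ * a i) = 2 * toronZPE L κ 0 φ := by
  rw [h.sum_eq_sum (isDiag_twCurl_pwFrame L φ) (fun y => modeZPE (κ * y)), sum_modeZPE_pwValue]

/-! ## §4 The neutral (real) sector: the plain curl on real scalar link fields and its complexification -/

/-- The plain curl on real scalar link functions. [cite: Wilson1974] -/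
def reCurlFun : (Edge 3 L → ℝ) →ₗ[ℝ] (Plaquette 3 L → ℝ) where
  toFun u q := u (q.1, q.2.1.1) + u (q.1.shift q.2.1.1, q.2.1.2) - u (q.1.shift q.2.1.2, q.2.1.1) - u (q.1, q.2.1.2)
  map_add' v w := by funext q; simp only [Pi.add_apply]; ring
  map_smul' r v := by funext q; simp only [Pi.smul_apply, smul_eq_mul, RingHom.id_apply]; ring

/-- **The real scalar curl** `d : ℝ^{Edge} → ℝ^{Plaquette}` (Euclidean structures). [cite: Wilson1974] -/
def reCurl : EuclideanSpace ℝ (Edge 3 L) →ₗ[ℝ] EuclideanSpace ℝ (Plaquette 3 L) :=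
  (WithLp.linearEquiv 2 ℝ (Plaquette 3 L → ℝ)).symm.toLinearMap ∘ₗ reCurlFun L ∘ₗ (WithLp.linearEquiv 2 ℝ (Edge 3 L → ℝ)).toLinearMap

omit [NeZero L] in
/-- Components of the real scalar curl. [cite: Wilson1974] -/
theorem reCurl_apply (u : EuclideanSpace ℝ (Edge 3 L)) (x : Site 3 L) (kl : {q : Fin 3 × Fin 3 // q.1 < q.2}) :
    reCurl L u (x, kl) = u (x, kl.1.1) + u (x.shift kl.1.1, kl.1.2) - u (x.shift kl.1.2, kl.1.1) - u (x, kl.1.2) := by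
  simp [reCurl, reCurlFun]

/-- Complexification of a real field (any index type). [folklore] -/
def cplx {α : Type*} (u : EuclideanSpace ℝ α) : EuclideanSpace ℂ α := WithLp.toLp 2 fun i => ((u i : ℝ) : ℂ)

/-- Components of the complexification. [folklore] -/
theorem cplx_apply {α : Type*} (u : EuclideanSpace ℝ α) (i : α) : cplx u i = ((u i : ℝ) : ℂ) := rfl

/-- Complexification preserves inner products: `⟪u_ℂ, u'_ℂ⟫_ℂ = ⟪u, u'⟫_ℝ`. [folklore] -/
theorem inner_cplx {α : Type*} [Fintype α] (u u' : EuclideanSpace ℝ α) : ⟪cplx u, cplx u'⟫_ℂ = ((⟪u, u'⟫_ℝ : ℝ) : ℂ) := by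
  rw [PiLp.inner_apply, PiLp.inner_apply, Complex.ofReal_sum]
  refine sum_congr rfl fun i _ => ?_
  simp only [cplx_apply, RCLike.inner_apply, Complex.conj_ofReal, RCLike.conj_to_real, Complex.ofReal_mul]

omit [NeZero L] in
/-- The complexified real curl is the untwisted complex curl: `D_0(u_ℂ) = (d u)_ℂ`. [folklore] -/
theorem twCurl_zero_cplx (u : EuclideanSpace ℝ (Edge 3 L)) : twCurl L 0 (cplx u) = cplx (reCurl L u) := by
  ext ⟨x, kl⟩
  simp only [twCurl_apply, cplx_apply, reCurl_apply, twPhase, Pi.zero_apply, Complex.ofReal_zero, zero_mul, Complex.exp_zero, one_mul]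
  push_cast
  ring

/-- A real orthonormal frame of `ℝ^{Edge}` complexifies to an orthonormal basis of `ℂ^{Edge}`. [folklore] -/
theorem orthonormal_cplx {ι : Type*} [Fintype ι] (e : OrthonormalBasis ι ℝ (EuclideanSpace ℝ (Edge 3 L))) :
    Orthonormal ℂ (fun i => cplx (e i)) := by
  classical
  rw [orthonormal_iff_ite]
  intro i j
  rw [inner_cplx, orthonormal_iff_ite.mp e.orthonormal i j]
  split_ifs <;> simp

/-- The complexified frame as an orthonormal basis of `ℂ^{Edge}`. [folklore] -/
def cplxFrame {ι : Type*} [Fintype ι] (e : OrthonormalBasis ι ℝ (EuclideanSpace ℝ (Edge 3 L))) :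
    OrthonormalBasis ι ℂ (EuclideanSpace ℂ (Edge 3 L)) :=
  OrthonormalBasis.mk (orthonormal_cplx L e) ((orthonormal_cplx L e).linearIndependent.span_eq_top_of_card_eq_finrank'
    (by rw [← finrank_eq_card_basis e.toBasis, finrank_euclideanSpace, finrank_euclideanSpace])).ge

/-- The complexified frame's vectors. [folklore] -/
theorem cplxFrame_apply {ι : Type*} [Fintype ι] (e : OrthonormalBasis ι ℝ (EuclideanSpace ℝ (Edge 3 L))) (i : ι) :
    cplxFrame L e i = cplx (e i) := by
  rw [cplxFrame, OrthonormalBasis.coe_mk]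

/-- A real frame diagonalising `‖d·‖²` complexifies to a frame diagonalising `‖D_0·‖²` with the same values. [folklore] -/
theorem isDiag_cplxFrame {ι : Type*} [Fintype ι] [DecidableEq ι] {e : OrthonormalBasis ι ℝ (EuclideanSpace ℝ (Edge 3 L))}
    {a : ι → ℝ} (h : Frame.IsDiag (reCurl L) e a) : Frame.IsDiag (twCurl L 0) (cplxFrame L e) a := fun i j => by
  rw [cplxFrame_apply, cplxFrame_apply, twCurl_zero_cplx, twCurl_zero_cplx, inner_cplx, h i j]
  split_ifs <;> simp

/-- ★★ **NEUTRAL-SECTOR SPECTRAL SUM, frame-free**: for EVERY real orthonormal frame `(e, a)` of `ℝ^{Edge}` diagonalising the plain curl's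
form `‖d u‖²`, `Σᵢ modeZPE(κ aᵢ) = 2·toronZPE L κ 0 0` (real multiplicity 2 per momentum). [cite: Luscher1983, §3] -/
theorem sum_modeZPE_of_isDiag_reCurl {ι : Type*} [Fintype ι] [DecidableEq ι] {e : OrthonormalBasis ι ℝ (EuclideanSpace ℝ (Edge 3 L))}
    {a : ι → ℝ} (h : Frame.IsDiag (reCurl L) e a) (κ : ℝ) : ∑ i, modeZPE (κ * a i) = 2 * toronZPE L κ 0 0 :=
  sum_modeZPE_of_isDiag_twCurl L 0 (isDiag_cplxFrame L h) κ

end Summit.QuantumFields.YangMills.Theorems.FemtoTransferGap.TwoLattice.Toron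

end
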